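import Summits.AtomisticToContinuum.BoseEinsteinCondensation.Theorems.BECHeatBathGapSquareSummableInfluenceIdealGas
import Summits.AtomisticToContinuum.BoseEinsteinCondensation.Theorems.BECCutLineWeakDisorderGroundStateRigidityLocBddAllDensities
import Summits.AtomisticToContinuum.BoseEinsteinCondensation.Theorems.BECHeatBathGapSomeNearMinimiserCondenses
import Literature.MathematicalPhysics.QuantumManyBody.GroundState
import Literature.MathematicalPhysics.QuantumManyBody.OneParticleMarginals
import Literature.MathematicalPhysics.QuantumManyBody.BoseGasDirichletWall
import HarnessLib

/-!
# Route `BECHeatBathGap`, crux `SquareSummableInfluence` (stmt-AtomisticToContinuum-14368), line `registered`: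
# the ideal-gas rung of the physics stub in the ALL-GROUND-STATES pair form

Supports (does not close) stmt-AtomisticToContinuum-14368 (lead c3). Skeleton v3 of the line reduces the crux
to ONE physics stub `stub_allGroundStatesInfluence` in the "all-ground-states pair form": for EVERY closed-form
ground state `Θ₀` of `N` bodies in the box `Λ` of side `L' = ((N+1)/ρ)^{1/3}` there are a closed-form ground
state `Ψ₀` of `N + 1` bodies in the same box and bounded measurable predictors `g_i`, blind to the bath
particle `x_i = Z (Fin.succ i)`, with total squared influence `∑_i ∫_{Λ^{N+1}} |Ψ₀ − g_i Θ₀(tail)|² ≤ ε`.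
This file proves its **ideal-gas instance** (`v = 0`, EVERY density `ρ > 0`, eventually in `N`), upgrading
the existential form `groundStateInfluence_idealGas_box` (SOME `Θ₀`, SOME `Ψ₀`;
`…SquareSummableInfluenceIdealGas.lean`) to the `∀ Θ₀` form:

* `hasUniqueGroundState_zero` — the free Dirichlet ground state of `N ≥ 1` bodies in `Λ_L`, `L > 0`, is
  unique up to phase (the Perron–Frobenius theorem `hasUniqueGroundState_of_essLocBdd'` at `v = 0`, whose
  local-boundedness hypothesis is trivial);
* `setLIntegral_boxN_succ_congr_ae` — a.e. transport along the tail coordinates: two measurable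
  integrands on `Λ^{n+1}` whose fibres `X ↦ G(y, X)` agree a.e. for every first particle `y` have the same
  integral over `Λ^{n+1}` (restricted Tonelli `setLIntegral_box_boxN_vecCons`, `Λ × Λ^n ≃ Λ^{n+1}`);
* `allGroundStatesInfluence_idealGas` — the stub's conclusion at `v = 0`: given ANY free ground state `Θ₀`
  of `N ≥ 1` bodies, uniqueness gives a phase `c`, `|c| = 1`, with `Θ₀ = c Θ₁` a.e. for the product ground
  state `Θ₁` of `groundStateInfluence_idealGas_box`; the predictors `c⁻¹ g_i` (same bound, same blindness)
  then have, term by term, the same influence on `(Ψ₁, Θ₀)` as `g_i` on `(Ψ₁, Θ₁)`, hence `≤ ε`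
  (`N = 0` is discarded by `∀ᶠ N`).

## References

* M. Reed, B. Simon, *Methods of Modern Mathematical Physics IV* (1978), §XIII.12 Thms XIII.46–47
  (uniqueness of the ground state up to phase).
-/

noncomputable section

open MeasureTheory Filter
open scoped ENNReal NNReal Topology

namespace Summit.AtomisticToContinuum.BoseEinsteinCondensation.Theorems.SquareSummableInfluence

open Literature.MathematicalPhysics.QuantumManyBody.BoseGas
open Summit.AtomisticToContinuum.BoseEinsteinCondensation.Theorems.GroundStateRigidity
open Summit.AtomisticToContinuum.BoseEinsteinCondensation.Theorems

/-! ### Uniqueness of the free ground state and a.e. transport along the tail -/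

/-- **The free Dirichlet ground state is unique up to phase**: for `N ≥ 1` bodies in the box `Λ_L`,
`L > 0`, and `v = 0`, a nonnegative closed-form ground state exists and any two closed-form ground states
agree a.e. up to a constant phase (`hasUniqueGroundState_of_essLocBdd'` at `v = 0`: the zero potential is
measurable and bounded by `0` on every `[r, ∞)`). [cite: ReedSimonIV1978, §XIII.12 Thm XIII.47] -/
theorem hasUniqueGroundState_zero {N : ℕ} {L : ℝ} (hN : 1 ≤ N) (hL : 0 < L) :
    HasUniqueGroundState 0 N L :=
  hasUniqueGroundState_of_essLocBdd' N 0 L hN hL measurable_const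
    fun _ _ => ⟨0, Eventually.of_forall fun _ _ => by simp⟩

/-- **a.e. transport along the tail coordinates.** If two measurable integrands `G₁, G₂ ≥ 0` on
`Λ^{n+1}` have, for every position `y` of the first particle, a.e. equal fibres
`X ↦ G₁(y, X)`, `X ↦ G₂(y, X)` on `(ℝ³)^n`, then `∫_{Λ^{n+1}} G₁ = ∫_{Λ^{n+1}} G₂` (restricted Tonelli
`setLIntegral_box_boxN_vecCons` on both sides and `lintegral_congr_ae` in the tail). [folklore] -/
theorem setLIntegral_boxN_succ_congr_ae {n : ℕ} (L : ℝ) {G₁ G₂ : Config (n + 1) → ℝ≥0∞}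
    (h₁ : Measurable G₁) (h₂ : Measurable G₂)
    (h : ∀ y : Space, ∀ᵐ X : Config n, G₁ (Matrix.vecCons y X) = G₂ (Matrix.vecCons y X)) :
    ∫⁻ Z in boxN (n + 1) L, G₁ Z = ∫⁻ Z in boxN (n + 1) L, G₂ Z := by
  rw [← setLIntegral_box_boxN_vecCons L h₁, ← setLIntegral_box_boxN_vecCons L h₂]
  exact lintegral_congr fun y => lintegral_congr_ae (ae_restrict_of_ae (h y))

/-! ### The ideal-gas instance of the all-ground-states pair form -/

/-- **The physics stub of line `registered` (skeleton v3, all-ground-states pair form) holds for the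
ideal gas, at every density.** At `v = 0`, for every `ε > 0`, every `ρ > 0`, eventually in `N` (all
`N ≥ 1`), and for EVERY closed-form free ground state `Θ₀` of `N` bodies in the box of side
`L' = ((N+1)/ρ)^{1/3}`: there are a closed-form free ground state `Ψ₀` of `N + 1` bodies in the same box and
bounded measurable predictors `g_i`, blind to the bath particle `x_i`, with
`∑_i ∫_{Λ^{N+1}} |Ψ₀ − g_i Θ₀(tail)|² ≤ ε`. Proof: `groundStateInfluence_idealGas_box` supplies product
ground states `Θ₁ = u^{⊗N}`, `Ψ₁ = u^{⊗(N+1)}` and predictors `g_i` with influence `≤ ε`; by uniqueness of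
the free ground state up to phase (`hasUniqueGroundState_zero`) `Θ₀ = c Θ₁` a.e. with `|c| = 1`, so the
predictors `c⁻¹ g_i` have on `(Ψ₁, Θ₀)` term by term the same influence as `g_i` on `(Ψ₁, Θ₁)`
(`setLIntegral_boxN_succ_congr_ae`). [folklore] -/
theorem allGroundStatesInfluence_idealGas :
    ∀ ε : ℝ, 0 < ε → ∀ ρ : ℝ, 0 < ρ → ∀ᶠ N : ℕ in atTop,
      ∀ Θ₀ : Config N → ℂ, IsGroundState 0 (sideLength ρ (N + 1)) Θ₀ →
        ∃ Ψ₀ : Config (N + 1) → ℂ, IsGroundState 0 (sideLength ρ (N + 1)) Ψ₀ ∧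
        ∃ g : Fin N → Config (N + 1) → ℂ,
          (∀ i, Measurable (g i)) ∧ (∃ M : ℝ, ∀ i Z, ‖g i Z‖ ≤ M) ∧
          (∀ i Z x, g i (Function.update Z (Fin.succ i) x) = g i Z) ∧
          (∑ i : Fin N, ∫⁻ Z in boxN (N + 1) (sideLength ρ (N + 1)),
              (‖Ψ₀ Z - g i Z * Θ₀ (Matrix.vecTail Z)‖₊ : ℝ≥0∞) ^ 2) ≤ ENNReal.ofReal ε := by
  intro ε hε ρ hρ
  refine (eventually_ge_atTop 1).mono fun N hN Θ₀ hΘ₀ => ?_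
  have hL : 0 < sideLength ρ (N + 1) := sideLength_pos_of_pos hρ (Nat.succ_pos N)
  -- the product ground states and predictors of the existential form
  obtain ⟨Θ₁, Ψ₁, hΘ₁, hΨ₁, g, hgm, ⟨M, hgb⟩, hgu, hsum⟩ :=
    groundStateInfluence_idealGas_box hL N ε hε
  -- uniqueness up to phase: `Θ₀ = c Θ₁` a.e.
  obtain ⟨c, hc, hae⟩ := (hasUniqueGroundState_zero hN hL).2 Θ₁ Θ₀ hΘ₁ hΘ₀
  have hc0 : c ≠ 0 := by
    rw [← norm_ne_zero_iff, hc]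
    exact one_ne_zero
  have hcc : ∀ a b : ℂ, c⁻¹ * a * (c * b) = a * b := fun a b => by
    rw [show c⁻¹ * a * (c * b) = a * b * (c⁻¹ * c) by ring, inv_mul_cancel₀ hc0, mul_one]
  refine ⟨Ψ₁, hΨ₁, fun i Z => c⁻¹ * g i Z, fun i => (hgm i).const_mul _, ⟨M, fun i Z => ?_⟩,
    fun i Z x => ?_, ?_⟩
  · -- the bound: `|c⁻¹| = 1`
    rw [norm_mul, norm_inv, hc, inv_one, one_mul]
    exact hgb i Z
  · -- blindness to the bath particle `x_i`
    simp only [hgu]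
  · -- term by term the influence on `(Ψ₁, Θ₀)` equals that of `g_i` on `(Ψ₁, Θ₁)`
    refine (Finset.sum_congr rfl fun i _ => ?_).trans_le hsum
    have hGa : Measurable fun Z : Config (N + 1) =>
        (‖Ψ₁ Z - c⁻¹ * g i Z * Θ₀ (Matrix.vecTail Z)‖₊ : ℝ≥0∞) ^ 2 :=
      (hΨ₁.measurable.sub (((hgm i).const_mul _).mul
        (hΘ₀.measurable.comp measurable_vecTail))).nnnorm.coe_nnreal_ennreal.pow_const 2
    have hGb : Measurable fun Z : Config (N + 1) =>
        (‖Ψ₁ Z - g i Z * Θ₁ (Matrix.vecTail Z)‖₊ : ℝ≥0∞) ^ 2 :=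
      (hΨ₁.measurable.sub ((hgm i).mul
        (hΘ₁.measurable.comp measurable_vecTail))).nnnorm.coe_nnreal_ennreal.pow_const 2
    refine setLIntegral_boxN_succ_congr_ae _ hGa hGb fun y => hae.mono fun X hX => ?_
    simp only [Matrix.tail_cons, hX, hcc]

end Summit.AtomisticToContinuum.BoseEinsteinCondensation.Theorems.SquareSummableInfluence

end
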